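import Mathlib
import Summits.ValiantsHypothesis.ValiantsHypothesis.Theses.ProjectionRigidity
import Literature.Computability.AlgebraicComplexity.AlperBogartVelascoBoxThreeEq
import Literature.Computability.AlgebraicComplexity.LRPencilOfMatrix

/-!
# Crux `ProjectionRigidity.ProjOptimalUnique` (stmt-ValiantsHypothesis-16001), line `registered` (birth) —
registered stub `stub_twoLineThree`: THE TWO-LINE LEMMA for `7 × 7` representations of `per_3`

**Claim settled** (stub TL@3 of the lead's skeleton r2, TRUE).  Let `A` be ANY `7 × 7` matrix of affine
linear forms over `ℂ` with `det A = per_3` (in particular any optimal Valiant projection of `per_3`, since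
`pdc(per_3) = 7`, stub 0), and let `u`, `w` be left/right null vectors of its constant part `A(0)`.  Then
there is a line of the `3 × 3` variable grid — a row or a column — such that the border forms
`Σ_i u_i A_{ij}` (`j = 0..6`) and `Σ_j w_j A_{ij}` (`i = 0..6`) involve no variable of that line.
For Grenet's matrix the line is the middle row (`x_{2·}` label the internal arcs of the branching
program, never the source or sink arcs); the lemma says every size-`7` representation has such a
"middle line", which is the first step of the acyclic-normal-form / layer-uniqueness analysis at `n = 3`
(lead EVIDENCE-n3.md §1 (S2); worker anf3 (T1)).

Proof.  Alper–Bogart–Velasco's argument for `dc(per_3) ≥ 7` (tree: `AlperBogartVelascoSubspace`,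
replayed here because the tree's theorem hides the map `G`): in the normal form `V A U = Λ_{i₀} + Z(x)`,
`V(I) = ker G` (common zeros of the `i₀`-row and `i₀`-column forms) is a LINEAR subspace of `Sing(per_3)` of
dimension `≥ 9 − 6 = 3`.  NEW INPUT: `exists_line_of_subperm_two_vanish` (`AlperBogartVelascoBoxThreeEq`,
the equality case of ABV's dimension count): such a space is the space of matrices supported on one line.
Hence `G` kills the basis vectors of that line, i.e. the `i₀`-row of `V·A_v` and the `i₀`-column of
`A_v·U` vanish for `v` on the line; and `u`, `w` are scalar multiples of the `i₀`-row of `V` and the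
`i₀`-column of `U`, because `A(0)` has rank exactly `6` (ABV Prop. 2.1 = von zur Gathen) so its null
spaces are lines.  Unconditional (axioms `propext`, `Classical.choice`, `Quot.sound`).

References: [AlperBogartVelasco2017] Prop. 2.1, Thm. 1.2, Cor. 1.4; [Vonzurgathen1987] §2;
[HuttenhainIkenmeyer2016] §4 (Grenet's `7 × 7` matrix, the model case).
-/

-- layout Summits/ValiantsHypothesis/ValiantsHypothesis forces the duplicated namespace component
set_option linter.dupNamespace false

noncomputable section
namespace Summit.ValiantsHypothesis.ValiantsHypothesis.Theorems.ProjectionRigidityProjOptimalUnique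

open MvPolynomial Matrix Module
open Literature.Computability.AlgebraicComplexity
open Literature.Computability.AlgebraicComplexity.AlperBogartVelasco
open Literature.Computability.AlgebraicComplexity.VonZurGathen
open Literature.Computability.AlgebraicComplexity.LRPencil

/-- **TWO-LINE LEMMA for `7 × 7` representations of `per_3`** (registered stub `stub_twoLineThree`,
crux stmt-ValiantsHypothesis-16001, line `registered`).  Let `A` be a `7 × 7` matrix of affine linear
forms over `ℂ` with `det A = per_3`, and let `u` (resp. `w`) be any left (resp. right) null vector of
its constant part `A(0)`.  Then there is a LINE of the `3 × 3` grid — a row `r` or a column `r` — such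
that the border forms `Σ_i u_i A_{ij}` and `Σ_j w_j A_{ij}` have no coefficient on the variables of
that line.  Proof: Alper–Bogart–Velasco's `V(I) = ker G` for the normal form `V A U = Λ_{i₀} + Z(x)`
(tree: the proof of `exists_subspace_of_isAffineDetRepr_perPoly`, replayed to keep `G` explicit) is
a linear subspace of `Sing(per_3)` of dimension `≥ 3`, hence (`exists_line_of_subperm_two_vanish`,
the equality case of ABV Cor. 1.4's dimension count) the full `3`-space of matrices supported on one
line; so `G` kills the basis vectors of that line, i.e. the `i₀`-row and `i₀`-column coefficient
matrices of `V A U` vanish on the line's variables, and `u`, `w` are multiples of the `i₀`-row of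
`V` / `i₀`-column of `U` because `A(0)` has rank exactly `6` (ABV Prop. 2.1). -/
theorem stub_twoLineThree :
    ∀ A : Matrix (Fin 7) (Fin 7) (MvPolynomial (Fin 3 × Fin 3) ℂ),
      (∀ i j, (A i j).totalDegree ≤ 1) →
      A.det = Literature.Computability.AlgebraicComplexity.perPoly (Fin 3) ℂ →
      ∀ u w : Fin 7 → ℂ,
        Matrix.vecMul u (A.map MvPolynomial.constantCoeff) = 0 →
        Matrix.mulVec (A.map MvPolynomial.constantCoeff) w = 0 →
        ∃ (isRow : Bool) (r : Fin 3), ∀ v : Fin 3 × Fin 3, (if isRow then v.1 = r else v.2 = r) →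
          (∀ j, MvPolynomial.coeff (Finsupp.single v 1) (∑ i, u i • A i j) = 0) ∧
          (∀ i, MvPolynomial.coeff (Finsupp.single v 1) (∑ j, w j • A i j) = 0) := by
  intro A hdeg hdet u w hu hw
  have h2 : (2 : ℂ) ≠ 0 := two_ne_zero
  -- ===== ABV, replayed with `G` explicit (cf. `exists_subspace_of_isAffineDetRepr_perPoly`) =====
  have hrank : (constPart A).rank = Fintype.card (Fin 7) - 1 := by
    have hge : 7 ≤ (constPart A).rank + 1 := by
      rw [constPart_eq_map_eval_zero]
      exact le_rank_map_eval_add_one h2 (le_refl 3) A hdet 0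
    have hdet0 : (constPart A).det = 0 := by
      rw [det_constPart, hdet, constantCoeff_perPoly ℂ (by norm_num)]
    have hlt := Matrix.rank_lt_card_of_det_eq_zero hdet0
    rw [Fintype.card_fin] at hlt ⊢
    omega
  obtain ⟨V, U, i₀, hV, hU, hVU⟩ :=
    exists_mul_mul_eq_lamMatrix (constPart A) hrank (by rw [Fintype.card_fin]; norm_num)
  set B : Matrix (Fin 7) (Fin 7) (MvPolynomial (Fin 3 × Fin 3) ℂ) := V.map C * A * U.map C with hB
  have hB0 : constPart B = lamMatrix ℂ i₀ := by
    rw [hB, constPart_mul, constPart_mul, constPart_map_C, constPart_map_C, hVU]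
  have hB1 : ∀ r j, (B r j).totalDegree ≤ 1 := by
    intro r j
    rw [hB, Matrix.mul_apply]
    refine totalDegree_finsetSum_le fun l _ => ?_
    rw [Matrix.mul_apply, Matrix.map_apply]
    refine (totalDegree_mul _ _).trans ?_
    rw [totalDegree_C, add_zero]
    refine totalDegree_finsetSum_le fun k _ => ?_
    rw [Matrix.map_apply]
    refine (totalDegree_mul _ _).trans ?_
    rw [totalDegree_C, zero_add]
    exact hdeg k l
  set c : ℂ := V.det * U.det with hc
  have hc0 : c ≠ 0 :=
    mul_ne_zero ((Matrix.isUnit_iff_isUnit_det V).1 hV).ne_zero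
      ((Matrix.isUnit_iff_isUnit_det U).1 hU).ne_zero
  have hdetB : B.det = C c * perPoly (Fin 3) ℂ := by
    have hVd : (V.map (C : ℂ →+* MvPolynomial (Fin 3 × Fin 3) ℂ)).det = C V.det := by
      rw [← RingHom.mapMatrix_apply, ← RingHom.map_det]
    have hUd : (U.map (C : ℂ →+* MvPolynomial (Fin 3 × Fin 3) ℂ)).det = C U.det := by
      rw [← RingHom.mapMatrix_apply, ← RingHom.map_det]
    rw [hB, Matrix.det_mul, Matrix.det_mul, hdet, hVd, hUd, hc, map_mul]
    ring
  have hhom := perPoly_isHomogeneous (n := Fin 3) (k := ℂ)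
  have hcc1 : ∀ a, constantCoeff (pderiv a (perPoly (Fin 3) ℂ)) = 0 := fun a =>
    constantCoeff_eq_zero_of_isHomogeneous hhom.pderiv (by rw [Fintype.card_fin]; norm_num)
  have hcc2 : ∀ a b, constantCoeff (pderiv b (pderiv a (perPoly (Fin 3) ℂ))) = 0 := fun a b =>
    constantCoeff_eq_zero_of_isHomogeneous hhom.pderiv.pderiv (by rw [Fintype.card_fin]; norm_num)
  have h00 : ∀ a, coeffMat B a i₀ i₀ = 0 := by
    intro a
    rw [← constantCoeff_pderiv_det hB1 hB0 a, hdetB, pderiv_C_mul, map_mul, constantCoeff_C,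
      hcc1, mul_zero]
  have hquad : ∀ a b, ∑ s, (coeffMat B a i₀ s * coeffMat B b s i₀ +
      coeffMat B b i₀ s * coeffMat B a s i₀) = 0 := by
    intro a b
    have h := constantCoeff_pderiv_pderiv_det hB1 hB0 h00 a b
    rw [hdetB, pderiv_C_mul, pderiv_C_mul, map_mul, constantCoeff_C, hcc2, mul_zero] at h
    exact neg_eq_zero.1 h.symm
  let G : (Fin 3 × Fin 3 → ℂ) →ₗ[ℂ] (Fin 7 → ℂ) × (Fin 7 → ℂ) :=
    { toFun := fun x => (fun j => ∑ v, x v * coeffMat B v i₀ j, fun j => ∑ v, x v * coeffMat B v j i₀)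
      map_add' := fun x y => by
        ext j <;> simp [add_mul, Finset.sum_add_distrib]
      map_smul' := fun r x => by
        ext j <;> simp [Finset.mul_sum, mul_assoc] }
  have hN : ∀ (x : Fin 3 × Fin 3 → ℂ) (i j : Fin 7),
      (∑ v, x v • coeffMat B v) i j = ∑ v, x v * coeffMat B v i j := by
    intro x i j
    simp [Matrix.sum_apply]
  set W : Submodule ℂ (Fin 3 × Fin 3 → ℂ) := LinearMap.ker G with hWdef
  -- `dim W ≥ 3`
  have hW3 : 3 ≤ finrank ℂ W := by
    have hiso : ∀ z ∈ LinearMap.range G, ∀ z' ∈ LinearMap.range G,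
        z.1 ⬝ᵥ z'.2 + z'.1 ⬝ᵥ z.2 = 0 := by
      rintro _ ⟨x, rfl⟩ _ ⟨x', rfl⟩
      have e1 : ∑ j, (∑ v, x v * coeffMat B v i₀ j) * (∑ v', x' v' * coeffMat B v' j i₀) =
          ∑ v, ∑ v', x v * x' v' * ∑ j, coeffMat B v i₀ j * coeffMat B v' j i₀ := by
        calc ∑ j, (∑ v, x v * coeffMat B v i₀ j) * (∑ v', x' v' * coeffMat B v' j i₀)
            = ∑ j, ∑ v, ∑ v', (x v * coeffMat B v i₀ j) * (x' v' * coeffMat B v' j i₀) := by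
              refine Finset.sum_congr rfl fun j _ => ?_
              rw [Finset.sum_mul_sum]
          _ = ∑ v, ∑ v', ∑ j, (x v * coeffMat B v i₀ j) * (x' v' * coeffMat B v' j i₀) := by
              rw [Finset.sum_comm]
              refine Finset.sum_congr rfl fun v _ => ?_
              rw [Finset.sum_comm]
          _ = ∑ v, ∑ v', x v * x' v' * ∑ j, coeffMat B v i₀ j * coeffMat B v' j i₀ := by
              refine Finset.sum_congr rfl fun v _ => Finset.sum_congr rfl fun v' _ => ?_
              rw [Finset.mul_sum]
              refine Finset.sum_congr rfl fun j _ => ?_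
              ring
      have e2 : ∑ j, (∑ v', x' v' * coeffMat B v' i₀ j) * (∑ v, x v * coeffMat B v j i₀) =
          ∑ v, ∑ v', x v * x' v' * ∑ j, coeffMat B v' i₀ j * coeffMat B v j i₀ := by
        calc ∑ j, (∑ v', x' v' * coeffMat B v' i₀ j) * (∑ v, x v * coeffMat B v j i₀)
            = ∑ j, ∑ v', ∑ v, (x' v' * coeffMat B v' i₀ j) * (x v * coeffMat B v j i₀) := by
              refine Finset.sum_congr rfl fun j _ => ?_
              rw [Finset.sum_mul_sum]
          _ = ∑ v', ∑ v, ∑ j, (x' v' * coeffMat B v' i₀ j) * (x v * coeffMat B v j i₀) := by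
              rw [Finset.sum_comm]
              refine Finset.sum_congr rfl fun v' _ => ?_
              rw [Finset.sum_comm]
          _ = ∑ v, ∑ v', x v * x' v' * ∑ j, coeffMat B v' i₀ j * coeffMat B v j i₀ := by
              rw [Finset.sum_comm]
              refine Finset.sum_congr rfl fun v _ => Finset.sum_congr rfl fun v' _ => ?_
              rw [Finset.mul_sum]
              refine Finset.sum_congr rfl fun j _ => ?_
              ring
      show (∑ j, (∑ v, x v * coeffMat B v i₀ j) * (∑ v', x' v' * coeffMat B v' j i₀)) +
        ∑ j, (∑ v', x' v' * coeffMat B v' i₀ j) * (∑ v, x v * coeffMat B v j i₀) = 0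
      rw [e1, e2, ← Finset.sum_add_distrib]
      refine Finset.sum_eq_zero fun v _ => ?_
      rw [← Finset.sum_add_distrib]
      refine Finset.sum_eq_zero fun v' _ => ?_
      rw [← mul_add, ← Finset.sum_add_distrib, hquad v v', mul_zero]
    have h0' : ∀ z ∈ LinearMap.range G, z.1 i₀ = 0 ∧ z.2 i₀ = 0 := by
      rintro _ ⟨x, rfl⟩
      refine ⟨?_, ?_⟩
      · show ∑ v, x v * coeffMat B v i₀ i₀ = 0
        exact Finset.sum_eq_zero fun v _ => by rw [h00 v, mul_zero]
      · show ∑ v, x v * coeffMat B v i₀ i₀ = 0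
        exact Finset.sum_eq_zero fun v _ => by rw [h00 v, mul_zero]
    have hrange := finrank_add_one_le_card_of_isotropic (LinearMap.range G) i₀ hiso h0'
    have hrn := LinearMap.finrank_range_add_finrank_ker G
    rw [finrank_fintype_fun_eq_card, Fintype.card_prod, Fintype.card_fin] at hrn
    rw [Fintype.card_fin] at hrange
    rw [hWdef]
    omega
  -- `W ⊆ Sing(per_3)`: all `2 × 2` subpermanents vanish on `W`
  have hWsing : ∀ x ∈ W, ∀ r c' : Fin 3,
      ((Matrix.of fun i j => x (i, j)).submatrix r.succAbove c'.succAbove).permanent = 0 := by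
    intro x hx r c'
    have hx' : G x = 0 := LinearMap.mem_ker.1 hx
    have hrow : ∀ j, (∑ v, x v • coeffMat B v) i₀ j = 0 := fun j => by
      rw [hN]; exact congr_fun (congr_arg Prod.fst hx') j
    have hcol : ∀ j, (∑ v, x v • coeffMat B v) j i₀ = 0 := fun j => by
      rw [hN]; exact congr_fun (congr_arg Prod.snd hx') j
    have h := eval_pderiv_det_eq_zero hB1 hB0 (r, c') (h00 (r, c')) x hrow hcol
    rw [hdetB, pderiv_C_mul, map_mul, eval_C] at h
    have hvan := (mul_eq_zero.1 h).resolve_left hc0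
    have key : MvPolynomial.eval x (MvPolynomial.pderiv (r, c') (perPoly (Fin 3) ℂ)) =
        ((Matrix.of fun i j => x (i, j)).submatrix r.succAbove c'.succAbove).permanent := by
      rw [pderiv_perPoly, ← MvPolynomial.aeval_eq_eval, aeval_subperm_X,
        Matrix.subperm_eq_permanent_of_equiv _ (finSuccAboveEquiv c') (finSuccAboveEquiv r)]
      rfl
    rw [← key]
    exact hvan
  -- ===== the equality case: `W` is a line space =====
  -- `G` kills a vector iff the `i₀`-row and `i₀`-column coefficient matrices pair to zero with it
  have hGsingle : ∀ v : Fin 3 × Fin 3, (Pi.single v 1 : Fin 3 × Fin 3 → ℂ) ∈ W →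
      (∀ j, coeffMat B v i₀ j = 0) ∧ ∀ j, coeffMat B v j i₀ = 0 := by
    intro v hv
    have hx' : G (Pi.single v 1) = 0 := LinearMap.mem_ker.1 hv
    have e1 : ∀ j, ∑ v', (Pi.single v 1 : Fin 3 × Fin 3 → ℂ) v' * coeffMat B v' i₀ j = 0 :=
      fun j => congr_fun (congr_arg Prod.fst hx') j
    have e2 : ∀ j, ∑ v', (Pi.single v 1 : Fin 3 × Fin 3 → ℂ) v' * coeffMat B v' j i₀ = 0 :=
      fun j => congr_fun (congr_arg Prod.snd hx') j
    refine ⟨fun j => ?_, fun j => ?_⟩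
    · have := e1 j
      simp only [Pi.single_apply, ite_mul, one_mul, zero_mul, Finset.sum_ite_eq',
        Finset.mem_univ, if_true] at this
      exact this
    · have := e2 j
      simp only [Pi.single_apply, ite_mul, one_mul, zero_mul, Finset.sum_ite_eq',
        Finset.mem_univ, if_true] at this
      exact this
  -- the basis vectors of the line lie in `W`
  have hline : ∃ (isRow : Bool) (r : Fin 3), ∀ v : Fin 3 × Fin 3,
      (if isRow then v.1 = r else v.2 = r) → (Pi.single v 1 : Fin 3 × Fin 3 → ℂ) ∈ W := by
    -- a line space containing `W` injects `W` into `ℂ³`; dimension `3` makes it onto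
    have lineCase : ∀ (ℓ : Fin 3 → Fin 3 × Fin 3), Function.Injective ℓ →
        (∀ x ∈ W, ∀ v, (∀ t, v ≠ ℓ t) → x v = 0) →
        ∀ t, (Pi.single (ℓ t) 1 : Fin 3 × Fin 3 → ℂ) ∈ W := by
      intro ℓ hℓ hsupp t
      let π : (Fin 3 × Fin 3 → ℂ) →ₗ[ℂ] (Fin 3 → ℂ) := LinearMap.funLeft ℂ ℂ ℓ
      have hker : (W ⊓ LinearMap.ker π : Submodule ℂ _) = ⊥ := by
        rw [eq_bot_iff]
        intro x hx
        obtain ⟨hxW, hxk⟩ := Submodule.mem_inf.1 hx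
        rw [LinearMap.mem_ker] at hxk
        rw [Submodule.mem_bot]
        funext v
        by_cases hv : ∃ t, v = ℓ t
        · obtain ⟨t, rfl⟩ := hv
          have := congr_fun hxk t
          rwa [LinearMap.funLeft_apply] at this
        · push Not at hv
          exact hsupp x hxW v hv
      have hdimmap : finrank ℂ (W.map π) = finrank ℂ W := by
        rw [finrank_eq_finrank_map_add_finrank_inf_ker W π, hker, finrank_bot, add_zero]
      have htop : W.map π = ⊤ := by
        apply Submodule.eq_top_of_finrank_eq
        apply le_antisymm
        · exact (Submodule.finrank_le _).trans (le_refl _)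
        · rw [finrank_fintype_fun_eq_card, Fintype.card_fin, hdimmap]; exact hW3
      have hmem : (Pi.single t 1 : Fin 3 → ℂ) ∈ W.map π := by rw [htop]; exact Submodule.mem_top
      rw [Submodule.mem_map] at hmem
      obtain ⟨x, hxW, hxe⟩ := hmem
      have hxeq : x = Pi.single (ℓ t) 1 := by
        funext v
        by_cases hv : ∃ t', v = ℓ t'
        · obtain ⟨t', rfl⟩ := hv
          have := congr_fun hxe t'
          rw [LinearMap.funLeft_apply] at this
          rw [this, Pi.single_apply, Pi.single_apply]
          by_cases htt : t' = t
          · rw [htt, if_pos rfl, if_pos rfl]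
          · rw [if_neg htt, if_neg (fun h => htt (hℓ h))]
        · push Not at hv
          rw [hsupp x hxW v hv, Pi.single_apply, if_neg (hv t)]
      rw [← hxeq]; exact hxW
    rcases exists_line_of_subperm_two_vanish h2 W hWsing hW3 with ⟨r, hr⟩ | ⟨c', hc'⟩
    · refine ⟨true, r, fun v hv => ?_⟩
      have hvr : v.1 = r := by simpa using hv
      have key := lineCase (fun t => (r, t)) (fun a b h => (Prod.mk.inj h).2)
        (fun x hx v hv' => hr x hx v.1 v.2 fun h => hv' v.2 (by ext <;> simp [h])) v.2
      have : ((r, v.2) : Fin 3 × Fin 3) = v := by ext <;> simp [hvr]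
      rwa [this] at key
    · refine ⟨false, c', fun v hv => ?_⟩
      have hvc : v.2 = c' := by simpa using hv
      have key := lineCase (fun t => (t, c')) (fun a b h => (Prod.mk.inj h).1)
        (fun x hx v hv' => hc' x hx v.1 v.2 fun h => hv' v.1 (by ext <;> simp [h])) v.1
      have : ((v.1, c') : Fin 3 × Fin 3) = v := by ext <;> simp [hvc]
      rwa [this] at key
  -- ===== back to `A`, `u`, `w` =====
  obtain ⟨isRow, r, hr⟩ := hline
  refine ⟨isRow, r, fun v hv => ?_⟩
  obtain ⟨hrowB, hcolB⟩ := hGsingle v (hr v hv)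
  have hUdet : IsUnit U.det := (Matrix.isUnit_iff_isUnit_det U).1 hU
  have hVdet : IsUnit V.det := (Matrix.isUnit_iff_isUnit_det V).1 hV
  have hBv : coeffMat B v = V * coeffMat A v * U := by rw [hB, coeffMat_C_mul_mul_C]
  -- row `i₀` of `V · A_v` and column `i₀` of `A_v · U` vanish
  have hrowVA : ∀ j, (V * coeffMat A v) i₀ j = 0 := by
    intro j
    have e : (V * coeffMat A v) = (V * coeffMat A v * U) * U⁻¹ := by
      rw [Matrix.mul_assoc (V * coeffMat A v), Matrix.mul_nonsing_inv U hUdet, Matrix.mul_one]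
    rw [e, Matrix.mul_apply]
    exact Finset.sum_eq_zero fun l _ => by rw [← hBv, hrowB l, zero_mul]
  have hcolAU : ∀ j, (coeffMat A v * U) j i₀ = 0 := by
    intro j
    have e : (coeffMat A v * U) = V⁻¹ * (V * coeffMat A v * U) := by
      rw [Matrix.mul_assoc V, ← Matrix.mul_assoc V⁻¹, Matrix.nonsing_inv_mul V hVdet, Matrix.one_mul]
    rw [e, Matrix.mul_apply]
    exact Finset.sum_eq_zero fun l _ => by rw [← hBv, hcolB l, mul_zero]
  -- `u` is a multiple of the `i₀`-row of `V`, `w` of the `i₀`-column of `U` (null spaces of rank-6 `A(0)`)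
  have hgrow : Matrix.vecMul (fun i => V i₀ i) (constPart A) = 0 := by
    have e : Matrix.vecMul (fun i => V i₀ i) (constPart A) =
        fun j => (V * constPart A * U * U⁻¹) i₀ j := by
      funext j
      rw [Matrix.mul_assoc (V * constPart A), Matrix.mul_nonsing_inv U hUdet, Matrix.mul_one]
      rfl
    rw [e, hVU]
    funext j
    rw [Matrix.mul_apply, Pi.zero_apply]
    exact Finset.sum_eq_zero fun l _ => by simp [lamMatrix_apply]
  have hgcol : Matrix.mulVec (constPart A) (fun l => U l i₀) = 0 := by
    have e : Matrix.mulVec (constPart A) (fun l => U l i₀) =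
        fun j => (V⁻¹ * (V * constPart A * U)) j i₀ := by
      funext j
      rw [Matrix.mul_assoc V, ← Matrix.mul_assoc V⁻¹, Matrix.nonsing_inv_mul V hVdet, Matrix.one_mul]
      rfl
    rw [e, hVU]
    have hl0 : ∀ l, lamMatrix ℂ i₀ l i₀ = 0 := fun l => by
      rw [lamMatrix_apply]
      by_cases h : l = i₀ <;> simp [h]
    funext j
    rw [Matrix.mul_apply, Pi.zero_apply]
    exact Finset.sum_eq_zero fun l _ => by rw [hl0 l, mul_zero]
  have hgrow0 : (fun i => V i₀ i) ≠ 0 := by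
    intro h0
    apply hVdet.ne_zero
    exact Matrix.det_eq_zero_of_row_eq_zero i₀ fun j => congr_fun h0 j
  have hgcol0 : (fun l => U l i₀) ≠ 0 := by
    intro h0
    apply hUdet.ne_zero
    exact Matrix.det_eq_zero_of_column_eq_zero i₀ fun j => congr_fun h0 j
  have hrankA : (constPart A).rank = 6 := by rw [hrank, Fintype.card_fin]
  -- left null space
  obtain ⟨cu, hcu⟩ : ∃ cu : ℂ, cu • (fun i => V i₀ i) = u := by
    let KL : Submodule ℂ (Fin 7 → ℂ) := LinearMap.ker (Matrix.mulVecLin (constPart A)ᵀ)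
    have memKL : ∀ z : Fin 7 → ℂ, z ∈ KL ↔ Matrix.vecMul z (constPart A) = 0 := fun z => by
      change (constPart A)ᵀ.mulVecLin z = 0 ↔ _
      rw [Matrix.mulVecLin_apply, Matrix.mulVec_transpose]
    have hKL1 : finrank ℂ KL = 1 := by
      have h := LinearMap.finrank_range_add_finrank_ker (Matrix.mulVecLin (constPart A)ᵀ)
      have hr : finrank ℂ (LinearMap.range (Matrix.mulVecLin (constPart A)ᵀ)) = 6 := by
        change (constPart A)ᵀ.rank = 6
        rw [Matrix.rank_transpose, hrankA]
      rw [finrank_fintype_fun_eq_card, Fintype.card_fin, hr] at h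
      change 6 + finrank ℂ KL = 7 at h
      omega
    have hg : (fun i => V i₀ i) ∈ KL := (memKL _).2 hgrow
    have hg0 : (⟨_, hg⟩ : KL) ≠ 0 := fun h => hgrow0 (congr_arg Subtype.val h)
    have huK : u ∈ KL := (memKL _).2 hu
    obtain ⟨cu, hcu⟩ := (finrank_eq_one_iff_of_nonzero' (⟨_, hg⟩ : KL) hg0).1 hKL1 ⟨u, huK⟩
    exact ⟨cu, congr_arg Subtype.val hcu⟩
  -- right null space
  obtain ⟨cw, hcw⟩ : ∃ cw : ℂ, cw • (fun l => U l i₀) = w := by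
    let KR : Submodule ℂ (Fin 7 → ℂ) := LinearMap.ker (Matrix.mulVecLin (constPart A))
    have memKR : ∀ z : Fin 7 → ℂ, z ∈ KR ↔ Matrix.mulVec (constPart A) z = 0 := fun z => by
      change (constPart A).mulVecLin z = 0 ↔ _
      rw [Matrix.mulVecLin_apply]
    have hKR1 : finrank ℂ KR = 1 := by
      have h := LinearMap.finrank_range_add_finrank_ker (Matrix.mulVecLin (constPart A))
      have hr : finrank ℂ (LinearMap.range (Matrix.mulVecLin (constPart A))) = 6 := hrankA
      rw [finrank_fintype_fun_eq_card, Fintype.card_fin, hr] at h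
      change 6 + finrank ℂ KR = 7 at h
      omega
    have hg : (fun l => U l i₀) ∈ KR := (memKR _).2 hgcol
    have hg0 : (⟨_, hg⟩ : KR) ≠ 0 := fun h => hgcol0 (congr_arg Subtype.val h)
    have hwK : w ∈ KR := (memKR _).2 hw
    obtain ⟨cw, hcw⟩ := (finrank_eq_one_iff_of_nonzero' (⟨_, hg⟩ : KR) hg0).1 hKR1 ⟨w, hwK⟩
    exact ⟨cw, congr_arg Subtype.val hcw⟩
  -- assemble
  refine ⟨fun j => ?_, fun i => ?_⟩
  · have e : MvPolynomial.coeff (Finsupp.single v 1) (∑ i, u i • A i j) =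
        cu * (V * coeffMat A v) i₀ j := by
      rw [coeff_sum, Matrix.mul_apply, Finset.mul_sum]
      refine Finset.sum_congr rfl fun i _ => ?_
      rw [← hcu, Pi.smul_apply, smul_eq_mul, smul_eq_C_mul, coeff_C_mul, coeffMat_apply]
      ring
    rw [e, hrowVA j, mul_zero]
  · have e : MvPolynomial.coeff (Finsupp.single v 1) (∑ j, w j • A i j) =
        cw * (coeffMat A v * U) i i₀ := by
      rw [coeff_sum, Matrix.mul_apply, Finset.mul_sum]
      refine Finset.sum_congr rfl fun j _ => ?_
      rw [← hcw, Pi.smul_apply, smul_eq_mul, smul_eq_C_mul, coeff_C_mul, coeffMat_apply]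
      ring
    rw [e, hcolAU i, mul_zero]

end Summit.ValiantsHypothesis.ValiantsHypothesis.Theorems.ProjectionRigidityProjOptimalUnique

end
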